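import Summits.ResolutionOfSingularities.ResolutionOfSingularities.Theorems.WallCutBottom
import Literature.AlgebraicGeometry.Resolution.PointBlowupIFPGiraud
import HarnessLib

/-!
# LossIsFatalLayer — the LOSS-LAYER CALCULUS: after a total loss the `u_j^m`-layer of the equation is a RIGID unit multiple
of one monomial along the whole wall-stay phase (kernel, hypothesis-free, port-free; all `p`, `e`, `K`, every loss defect)

decomp-res-lens-3, gen 27 (row 214 window, line (α)).  See the module docstring of `LossIsFatalLedger` for the programme.

THE ENGINE.  A total loss at `t` in chart `j` (`ordZero F_t = q + m`, `kept_t = 0`) makes the `u_j^m`-layer of `F_{t+1}`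
equal to `u_j^m · Ũ_t · N_t` with `Ũ_t(0) ≠ 0` (`loss_layer`); a proximity repeat into chart `i` (the power law
`ConeCut.resForm_eq_pow_of_repeat`) straightens it to `c · u_i^d u_j^m u_l^s · V`, `V(0) ≠ 0`, `m + s = q + d`
(`layer_after_repeat`).  A move in a chart `≠ j` that stays on the loss wall (`b(j) = 0`) transports the layer by
`Ψ = translate_b ∘ φ_chart` (layer locality `coeff_transport_congr`, constant term invariant `constantCoeff_transport`,
one step `run_step`).

THE LAWS (all PROVED here, every `q = pᵉ`, every shade, every defect):
* `run_letter_untranslated` / `loss_run_untranslated` (T5a) — every run letter after the first is UNTRANSLATED: a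
  translation `γ ≠ 0` along the third coordinate would create the monomial `c γ^s V(0) · u_i^{k+d} u_j^m` strictly below the
  order.  No horizon hypothesis (the run ledger `run_ledger` gives `ordZero F_{u+1} = s + k + d + m`).
* `run_no_side_switch` / `loss_run_no_side_switch` (T4⁰) — a move in the THIRD chart that stays on the loss wall is
  impossible on the plateau: forced untranslated first, then its transported layer monomial `u_l^{k+d} u_j^m u_i^k` lies below
  the order.  Hence the wall-stay phase after a loss is a straight chart-`i` run, untranslated from its second letter.
* `run_invariant` — the full invariant of the run (earlier letters untranslated, boundary `k e_i + m e_j`, layer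
  `c · u_i^k u_j^m u_l^s · V_k`).
(Landing part 1 of 2: §1, §2 and `layer_after_repeat`; part 2 = `LossIsFatalLayer2.lean`: the run.)
What remains for (R′) are the EXIT events of the run (chart-`j` exit, side switch LEAVING the loss wall, re-loss, run end) —
see NODE-g27.
-/


open MvPolynomial Finset
open Literature.AlgebraicGeometry.Resolution
open Literature.AlgebraicGeometry.Resolution.Hauser2010
open Literature.AlgebraicGeometry.Resolution.PointBlowup
open Literature.AlgebraicGeometry.Resolution.WeightedBlowup (coeff_translate_monomial coeff_translate_monomial_eq_zero_of_lt
  coeff_translate_monomial_eq_zero_of_apply_eq_zero)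
open Summit.ResolutionOfSingularities.ResolutionOfSingularities.Theorems.TightDefectClasses
open Summit.ResolutionOfSingularities.ResolutionOfSingularities.Theorems.TightDefectStrongWalks
open Summit.ResolutionOfSingularities.ResolutionOfSingularities.Theorems.ItineraryCutClasses
open Summit.ResolutionOfSingularities.ResolutionOfSingularities.Theorems.BoundaryLedger
open Summit.ResolutionOfSingularities.ResolutionOfSingularities.Theorems.ProximityCut
open Summit.ResolutionOfSingularities.ResolutionOfSingularities.Theorems.WallCutRun
open Summit.ResolutionOfSingularities.ResolutionOfSingularities.Theorems.WallCut
open Summit.ResolutionOfSingularities.ResolutionOfSingularities.Theorems.ConeCut (resForm resLayer initLayer bUnit bUnit_ne_zero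
  cone_of_plateau resForm_eq_pow_of_repeat coeff_step_layer initLayer_eq_mul update_apply' coeff_resForm_eq_zero
  translate_monomial_eq_self)

namespace Summit.ResolutionOfSingularities.ResolutionOfSingularities.Theorems.LossIsFatalLayer

/-! ## §1 The transport map `Ψ = translate_b ∘ φ_i` of a move and its layer locality -/

section Algebra

variable {K : Type} [Field K]

/-- The total-transform substitution `φ_i` of the `u_i`-chart: `u_w ↦ u_i u_w` (`w ≠ i`), `u_i ↦ u_i`.  DEFINITION (support). -/
noncomputable def chartMap (i : Fin 3) : MvPolynomial (Fin 3) K →ₐ[K] MvPolynomial (Fin 3) K :=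
  aeval (fun w => if w = i then (X i : MvPolynomial (Fin 3) K) else X i * X w)

/-- `chartMap_X`: the substitution on a variable. [folklore] -/
theorem chartMap_X (i w : Fin 3) : chartMap (K := K) i (X w) = if w = i then X i else X i * X w := by
  unfold chartMap
  rw [aeval_X]

/-- `chartMap_C`: constants are fixed. [folklore] -/
theorem chartMap_C (i : Fin 3) (c : K) : chartMap i (C c) = C c := by
  unfold chartMap
  rw [aeval_C, algebraMap_eq]

/-- `chartMap_monomial`: `φ_i(c·u^d) = c·u^{chartExponent 0 i d}`. (Sources: Hauser2010, §F (chart expressions of a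
point blowup).) -/
theorem chartMap_monomial (i : Fin 3) (d : Fin 3 →₀ ℕ) (c : K) :
    chartMap i (monomial d c) = monomial (chartExponent 0 i d) c :=
  aeval_chart_monomial i d c

/-- `chartMap_X_self`. [folklore] -/
theorem chartMap_X_self (i : Fin 3) : chartMap (K := K) i (X i) = X i := by
  rw [chartMap_X, if_pos rfl]

/-- `chartMap_X_ne`. [folklore] -/
theorem chartMap_X_ne {i w : Fin 3} (h : w ≠ i) : chartMap (K := K) i (X w) = X i * X w := by
  rw [chartMap_X, if_neg h]

/-- The chart exponent of a monomial written in three named coordinates. [folklore] -/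
theorem chartExponent_zero_three {i j l : Fin 3} (hij : i ≠ j) (hli : l ≠ i) (hlj : l ≠ j) (a m n : ℕ) :
    chartExponent 0 i (Finsupp.single i a + Finsupp.single j m + Finsupp.single l n) =
      Finsupp.single i (a + m + n) + Finsupp.single j m + Finsupp.single l n := by
  classical
  have hdeg : (Finsupp.single i a + Finsupp.single j m + Finsupp.single l n).degree = a + m + n := by
    rw [map_add, map_add, Finsupp.degree_single, Finsupp.degree_single, Finsupp.degree_single]
  ext w
  rw [chartExponent_apply, hdeg, Nat.sub_zero]
  simp only [Finsupp.add_apply, Finsupp.single_apply]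
  rcases ExitLaw.fin3_cases hij hli hlj w with h | h | h <;> subst h
  · simp [hij.symm, hli]
  · simp [hij, hlj, hij.symm]
  · simp [hli.symm, hlj.symm, hli]

/-- A monomial in three named coordinates as a product of powers. [folklore] -/
theorem monomial_three_eq {i j l : Fin 3} (a m n : ℕ) (c : K) :
    (monomial (Finsupp.single i a + Finsupp.single j m + Finsupp.single l n) c : MvPolynomial (Fin 3) K) =
      C c * X i ^ a * X j ^ m * X l ^ n := by
  rw [X_pow_eq_monomial, X_pow_eq_monomial, X_pow_eq_monomial, C_mul_monomial, monomial_mul, monomial_mul, mul_one,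
    mul_one, mul_one]

/-- `translate_X'`. [folklore] -/
theorem translate_X' (b : Fin 3 → K) (w : Fin 3) : PointBlowup.translate b (X w : MvPolynomial (Fin 3) K) = X w + C (b w) := by
  unfold PointBlowup.translate
  rw [aeval_X]

/-- `translate_C'`. [folklore] -/
theorem translate_C' (b : Fin 3 → K) (c : K) : PointBlowup.translate b (C c : MvPolynomial (Fin 3) K) = C c := by
  unfold PointBlowup.translate
  rw [aeval_C, algebraMap_eq]

/-- `translate_pow'`. [folklore] -/
theorem translate_pow' (b : Fin 3 → K) (P : MvPolynomial (Fin 3) K) (n : ℕ) : PointBlowup.translate b (P ^ n) = PointBlowup.translate b P ^ n := by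
  unfold PointBlowup.translate
  rw [map_pow]

/-- `translate_sub'`. [folklore] -/
theorem translate_sub' (b : Fin 3 → K) (P Q : MvPolynomial (Fin 3) K) : PointBlowup.translate b (P - Q) = PointBlowup.translate b P - PointBlowup.translate b Q := by
  unfold PointBlowup.translate
  rw [map_sub]

/-- **LAYER LOCALITY OF THE TRANSPORT, monomial form (PROVED).**  For a coordinate `j ≠ i` with `b_j = 0` the transport
`translate_b ∘ φ_i` preserves the `u_j`-exponent: `u^d` contributes nothing to exponents `D` with `D_j ≠ d_j`. [folklore] -/
theorem coeff_transport_monomial_eq_zero {i j : Fin 3} (hji : j ≠ i) (b : Fin 3 → K) (hbj : b j = 0)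
    (d D : Fin 3 →₀ ℕ) (c : K) (h : d j ≠ D j) : coeff D (PointBlowup.translate b (chartMap i (monomial d c))) = 0 := by
  classical
  rw [chartMap_monomial]
  have hcd : chartExponent 0 i d j = d j := by rw [chartExponent_apply, if_neg hji]
  rcases lt_or_gt_of_ne h with hlt | hgt
  · exact coeff_translate_monomial_eq_zero_of_lt b _ _ _ (show chartExponent 0 i d j < D j by rw [hcd]; exact hlt)
  · exact coeff_translate_monomial_eq_zero_of_apply_eq_zero b _ _ _ hbj
      (show D j < chartExponent 0 i d j by rw [hcd]; exact hgt)

/-- **LAYER LOCALITY (PROVED).**  Two polynomials that agree on the `u_j^n`-layer have transports agreeing on the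
`u_j^n`-layer (`j ≠ i`, `b_j = 0`). [folklore] -/
theorem coeff_transport_congr {i j : Fin 3} (hji : j ≠ i) (b : Fin 3 → K) (hbj : b j = 0) {n : ℕ}
    (P Q : MvPolynomial (Fin 3) K) (hPQ : ∀ d : Fin 3 →₀ ℕ, d j = n → coeff d P = coeff d Q)
    (D : Fin 3 →₀ ℕ) (hD : D j = n) :
    coeff D (PointBlowup.translate b (chartMap i P)) = coeff D (PointBlowup.translate b (chartMap i Q)) := by
  classical
  have key : ∀ R : MvPolynomial (Fin 3) K, (∀ d : Fin 3 →₀ ℕ, d j = n → coeff d R = 0) →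
      coeff D (PointBlowup.translate b (chartMap i R)) = 0 := by
    intro R hR
    rw [R.as_sum, map_sum]
    unfold PointBlowup.translate
    rw [map_sum, coeff_sum]
    refine Finset.sum_eq_zero fun d hd => ?_
    have hdj : d j ≠ D j := by
      intro h
      exact (mem_support_iff.mp hd) (hR d (h.trans hD))
    exact coeff_transport_monomial_eq_zero hji b hbj d D _ hdj
  have h := key (P - Q) (fun d hd => by rw [coeff_sub, hPQ d hd, sub_self])
  rwa [map_sub, translate_sub', coeff_sub, sub_eq_zero] at h

/-- **THE CONSTANT TERM IS INVARIANT UNDER THE TRANSPORT (PROVED)** (`b_i = 0`: the centre lies on the new component).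
[folklore] -/
theorem constantCoeff_transport (i : Fin 3) (b : Fin 3 → K) (hbi : b i = 0) (P : MvPolynomial (Fin 3) K) :
    constantCoeff (PointBlowup.translate b (chartMap i P)) = constantCoeff P := by
  induction P using MvPolynomial.induction_on with
  | C a => rw [chartMap_C, translate_C']
  | add P Q hP hQ =>
    rw [map_add]
    unfold PointBlowup.translate at *
    rw [map_add, map_add, hP, hQ, map_add]
  | mul_X P w hP =>
    rw [map_mul, translate_mul, map_mul, hP, map_mul, constantCoeff_X, mul_zero, chartMap_X]
    suffices h0 : constantCoeff (PointBlowup.translate b (if w = i then X i else X i * X w : MvPolynomial (Fin 3) K)) = 0 by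
      rw [h0, mul_zero]
    split_ifs with hw
    · rw [translate_X', map_add, constantCoeff_X, constantCoeff_C, hbi, zero_add]
    · rw [translate_mul, map_mul, translate_X', map_add, constantCoeff_X, constantCoeff_C, hbi, zero_add, zero_mul]

/-- Translating a monomial whose exponent meets the translation only at `u_l`:
`(u+b)^{a e_i + m e_j + n e_l} = u^{a e_i + m e_j} (u_l + b_l)^n` for `b_i = b_j = 0`. [folklore] -/
theorem translate_monomial_split (b : Fin 3 → K) {i j : Fin 3} (l : Fin 3) (hbi : b i = 0) (hbj : b j = 0)
    (a m n : ℕ) (c : K) :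
    PointBlowup.translate b (monomial (Finsupp.single i a + Finsupp.single j m + Finsupp.single l n) c) =
      monomial (Finsupp.single i a + Finsupp.single j m) c * (X l + C (b l)) ^ n := by
  classical
  have hsplit : (monomial (Finsupp.single i a + Finsupp.single j m + Finsupp.single l n) c : MvPolynomial (Fin 3) K) =
      C c * monomial (Finsupp.single i a + Finsupp.single j m) 1 * X l ^ n := by
    rw [C_mul_monomial, mul_one, X_pow_eq_monomial, monomial_mul, mul_one]
  have hfix : PointBlowup.translate b (monomial (Finsupp.single i a + Finsupp.single j m) (1 : K)) =
      monomial (Finsupp.single i a + Finsupp.single j m) 1 := by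
    refine translate_monomial_eq_self b _ fun w hw => ?_
    rw [Finsupp.add_apply, Finsupp.single_apply, Finsupp.single_apply] at hw
    by_cases hwi : i = w
    · rw [← hwi]; exact hbi
    · by_cases hwj : j = w
      · rw [← hwj]; exact hbj
      · rw [if_neg hwi, if_neg hwj, add_zero] at hw; exact absurd rfl hw
  rw [hsplit, translate_mul, translate_mul, translate_C', hfix, translate_pow', translate_X', C_mul_monomial, mul_one]

end Algebra

/-! ## §2 Along a forced walk: the transport identity and the loss layer -/

section Walk

variable {K : Type} [Field K] [DecidableEq K] {q : ℕ} {s₀ : State (Fin 3) K}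

/-- **THE TRANSPORT IDENTITY OF ONE MOVE (PROVED).**  For an exponent `D` that is not a `q`-th power,
`coeff_D F_{u+1} = coeff_{q e_i + D} (translate_{b_u} (φ_i F_u))` (`i = j_u`): the next equation is the transport of
the previous one divided by `u_i^q`, then cleaned. (Sources: Hauser2010, §F (chart expressions of a point blowup).) -/
theorem coeff_succ_transport (hroot : IsRoot q s₀) (W : ForcedWalk q s₀) (u : ℕ) (D : Fin 3 →₀ ℕ)
    (hD : ¬ IsPthPowerExponent q D) :
    coeff D (W.st (u + 1)).F =
      coeff (Finsupp.single (W.j u) q + D) (PointBlowup.translate (W.b u) (chartMap (W.j u) (W.st u).F)) := by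
  classical
  obtain ⟨o, ho, hqo⟩ := walk_nat hroot W u
  have hstep : (W.st (u + 1)).F = deletePthPowers q (pointTransform q (W.j u) (W.b u) (W.st u)) := by
    rw [W.st_succ]; rfl
  have hord : ((q : ℕ) : ℕ∞) ≤ ordZero (W.st u).F := by rw [ho]; exact_mod_cast hqo
  have hX : PointBlowup.translate (W.b u) (chartMap (W.j u) (W.st u).F) =
      X (W.j u) ^ q * PointBlowup.translate (W.b u) (chartTransform q (W.j u) (W.st u).F) := by
    have h1 : chartMap (W.j u) (W.st u).F = X (W.j u) ^ q * chartTransform q (W.j u) (W.st u).F :=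
      (X_pow_mul_chartTransform (W.j u) hord).symm
    rw [h1, translate_mul, translate_pow', translate_X', W.onExc u, C_0, add_zero]
  rw [hstep, coeff_deletePthPowers, if_neg hD, hX, X_pow_eq_monomial, coeff_monomial_mul, one_mul]
  rfl

/-- An exponent with a coordinate strictly between `0` and `q` is not a `q`-th power exponent. [folklore] -/
theorem not_isPthPowerExponent_of_lt {D : Fin 3 →₀ ℕ} {j : Fin 3} {m : ℕ} (hD : D j = m) (h1 : 1 ≤ m) (h2 : m < q) :
    ¬ IsPthPowerExponent q D := by
  intro h
  have hdvd := (isPthPowerExponent_iff q D).mp h j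
  rw [hD] at hdvd
  have := Nat.le_of_dvd (by omega) hdvd
  omega

/-- **THE FULL LAYER IDENTITY OF A MOVE (PROVED).**  On a step from order `o_t > q`, the whole `u_j^{o−q}`-layer of the next
equation (`j = j_t`) is the translated boundary factor times the residual form:
`coeff_{E + (o−q) e_j} F_{t+1} = coeff_E (Ũ_t · N_t)` for `E_j = 0`, `Ũ_t = (u + b_t)^{r_t[j ↦ 0]}`. [new] [folklore] -/
theorem coeff_layer_succ (hroot : IsRoot q s₀) (W : ForcedWalk q s₀) (t : ℕ) {o : ℕ} (ho : ordZero (W.st t).F = o)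
    (hqo : q < o) {E : Fin 3 →₀ ℕ} (hEj : E (W.j t) = 0) :
    coeff (E + Finsupp.single (W.j t) (o - q)) (W.st (t + 1)).F =
      coeff E (PointBlowup.translate (W.b t) (monomial ((W.st t).r.update (W.j t) 0) (1 : K)) * resForm W t o) := by
  classical
  obtain ⟨o₁, ho₁, -, ho2⟩ := NoJump.order_lt_two_mul hroot W t
  have hoo : o₁ = o := by have h := ho₁.symm.trans ho; exact_mod_cast h
  rw [hoo] at ho2
  have h := coeff_step_layer (W.j t) (W.b t) (W.onExc t) (W.st t) hqo ho2 hEj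
  rw [← W.st_succ] at h
  rw [h, initLayer_eq_mul (W.j t) (W.st t) (walk_r hroot W t) o, translate_mul]
  rfl

/-- The boundary factor of a TOTAL loss has a non-zero constant term `∏_{w ≠ j} b_w^{r_w}`: every positive old wall is
translated away (`kept_t = 0`). [folklore] -/
theorem constantCoeff_boundary_ne_zero (W : ForcedWalk q s₀) (t : ℕ) (hk : kept W t = 0) :
    constantCoeff (PointBlowup.translate (W.b t) (monomial ((W.st t).r.update (W.j t) 0) (1 : K))) ≠ 0 := by
  classical
  show coeff 0 _ ≠ 0
  rw [coeff_translate_monomial, one_mul]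
  refine Finset.prod_ne_zero_iff.mpr fun w _ => ?_
  rw [Finsupp.zero_apply, Nat.choose_zero_right, Nat.cast_one, one_mul, Nat.sub_zero, update_apply']
  split_ifs with hw
  · rw [pow_zero]; exact one_ne_zero
  · by_cases hb : W.b t w = 0
    · have h := DFunLike.congr_fun hk w
      rw [kept_apply, if_pos ⟨hw, hb⟩, Finsupp.zero_apply] at h
      rw [h, pow_zero]; exact one_ne_zero
    · exact pow_ne_zero _ hb

/-- **THE LOSS LAYER (PROVED).**  After a total loss at `t` (`ordZero F_t = q + m`, `m ≥ 1`, `kept_t = 0`), the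
`u_j^m`-layer of `F_{t+1}` IS `u_j^m · Ũ_t · N_t`: for every `D` with `D_j = m`,
`coeff_D F_{t+1} = coeff_D (u_j^m · (Ũ_t · N_t))`. [new] [folklore] -/
theorem loss_layer (hroot : IsRoot q s₀) (W : ForcedWalk q s₀) (t : ℕ) {m : ℕ}
    (hot : ordZero (W.st t).F = ((q + m : ℕ) : ℕ∞)) (h1m : 1 ≤ m) (D : Fin 3 →₀ ℕ) (hD : D (W.j t) = m) :
    coeff D (W.st (t + 1)).F = coeff D (monomial (Finsupp.single (W.j t) m) 1 *
      (PointBlowup.translate (W.b t) (monomial ((W.st t).r.update (W.j t) 0) (1 : K)) * resForm W t (q + m))) := by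
  classical
  have hEj : (Finsupp.erase (W.j t) D) (W.j t) = 0 := Finsupp.erase_same
  have h := coeff_layer_succ hroot W t hot (by omega) hEj
  rw [show q + m - q = m by omega] at h
  have hsplit : D = Finsupp.erase (W.j t) D + Finsupp.single (W.j t) m := by
    rw [← hD, Finsupp.erase_add_single]
  rw [hsplit, h, add_comm (Finsupp.erase (W.j t) D), coeff_monomial_mul, one_mul]

/-! ## §3 The loss layer along the run: shape after the proximity repeat, transport per letter, rigidity -/

/-- **THE LAYER AFTER THE PROXIMITY REPEAT (PROVED).**  Total loss at `t` (`ordZero F_t = q + m`, `kept_t = 0`) in chart `j`,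
then a proximity repeat into chart `i ≠ j` staying on the new wall (`StaysOnNewest W t`), on a plateau of shade `s` with
`ordZero F_{t+1} = q + d` (`m + s = q + d`; `d = 1` is the BOTTOM).  Then the whole `u_j^m`-layer of `F_{t+2}` is
`c · u_i^d u_j^m u_l^s · V` with `c ≠ 0` and `V(0) ≠ 0` — the power law `N_t = c (u_l − β u_i)^s` of the repeat
(`ConeCut.resForm_eq_pow_of_repeat`) is straightened by the transport: `Ψ(u_l − β u_i) = u_i u_l`. [new] [folklore] -/
theorem layer_after_repeat (hroot : IsRoot q s₀) (W : ForcedWalk q s₀) (t : ℕ) {s m d : ℕ} {l : Fin 3}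
    (hsh : (W.st t).shade = (s : ℕ∞)) (hplat : (W.st (t + 1)).shade = (W.st t).shade)
    (hplat' : (W.st (t + 2)).shade = (W.st (t + 1)).shade)
    (hot : ordZero (W.st t).F = ((q + m : ℕ) : ℕ∞)) (hot1 : ordZero (W.st (t + 1)).F = ((q + d : ℕ) : ℕ∞))
    (h1m : 1 ≤ m) (h1d : 1 ≤ d) (hms : m + s = q + d) (hk : kept W t = 0) (hst : StaysOnNewest W t)
    (hli : l ≠ W.j (t + 1)) (hlj : l ≠ W.j t) :
    ∃ c : K, c ≠ 0 ∧ ∃ V : MvPolynomial (Fin 3) K, constantCoeff V ≠ 0 ∧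
      ∀ D : Fin 3 →₀ ℕ, D (W.j t) = m → coeff D (W.st (t + 2)).F =
        coeff D (monomial (Finsupp.single (W.j (t + 1)) d + Finsupp.single (W.j t) m + Finsupp.single l s) c * V) := by
  classical
  have hmq : m < q := by
    obtain ⟨o₁, ho₁, -, ho2⟩ := NoJump.order_lt_two_mul hroot W t
    have : o₁ = q + m := by have h := ho₁.symm.trans hot; exact_mod_cast h
    omega
  obtain ⟨c, hc, hN⟩ := resForm_eq_pow_of_repeat hroot W t hot hot1 (by omega) (by omega) hplat hplat' hsh hst hli hlj
  have hbi : W.b (t + 1) (W.j (t + 1)) = 0 := W.onExc (t + 1)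
  have hbj : W.b (t + 1) (W.j t) = 0 := hst.2
  have hji : W.j t ≠ W.j (t + 1) := fun h => hst.1 h.symm
  refine ⟨c, hc, PointBlowup.translate (W.b (t + 1)) (chartMap (W.j (t + 1))
    (PointBlowup.translate (W.b t) (monomial ((W.st t).r.update (W.j t) 0) (1 : K)))), ?_, fun D hD => ?_⟩
  · rw [constantCoeff_transport _ _ hbi]
    exact constantCoeff_boundary_ne_zero W t hk
  · rw [coeff_succ_transport hroot W (t + 1) D (not_isPthPowerExponent_of_lt hD h1m hmq),
      coeff_transport_congr hji (W.b (t + 1)) hbj _ _ (loss_layer hroot W t hot h1m) (Finsupp.single (W.j (t + 1)) q + D)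
        (by rw [Finsupp.add_apply, Finsupp.single_apply, if_neg hji.symm, zero_add, hD]), hN]
    set i := W.j (t + 1) with hi
    set j := W.j t with hj
    set b := W.b (t + 1) with hb
    set U := PointBlowup.translate (W.b t) (monomial ((W.st t).r.update j 0) (1 : K)) with hU
    have h1 : PointBlowup.translate b (chartMap i (monomial (Finsupp.single j m) (1 : K))) = X i ^ m * X j ^ m := by
      rw [show (monomial (Finsupp.single j m) (1 : K) : MvPolynomial (Fin 3) K) = X j ^ m from X_pow_eq_monomial.symm,
        map_pow, chartMap_X_ne hji, translate_pow', translate_mul, translate_X', translate_X']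
      simp only [hbi, hbj, C_0, add_zero, mul_pow]
    have h2 : PointBlowup.translate b (chartMap i ((X l - C (b l) * X i) ^ s)) = X i ^ s * X l ^ s := by
      rw [map_pow, map_sub, map_mul, chartMap_C, chartMap_X_ne hli, chartMap_X_self, translate_pow', translate_sub',
        translate_mul, translate_mul, translate_C', translate_X', translate_X', hbi, C_0, add_zero]
      have hlin : (X i * (X l + C (b l)) - C (b l) * X i : MvPolynomial (Fin 3) K) = X i * X l := by ring
      rw [hlin, mul_pow]
    have hx : (X i : MvPolynomial (Fin 3) K) ^ m * X i ^ s = X i ^ q * X i ^ d := by rw [← pow_add, hms, pow_add]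
    have hΨ : PointBlowup.translate b (chartMap i (monomial (Finsupp.single j m) 1 * (U * (C c * (X l - C (b l) * X i) ^ s)))) =
        monomial (Finsupp.single i q) 1 * (monomial (Finsupp.single i d + Finsupp.single j m + Finsupp.single l s) c *
          PointBlowup.translate b (chartMap i U)) := by
      simp only [map_mul, translate_mul, chartMap_C, translate_C', h1, h2]
      rw [monomial_three_eq,
        show (monomial (Finsupp.single i q) (1 : K) : MvPolynomial (Fin 3) K) = X i ^ q from X_pow_eq_monomial.symm]
      calc _ = (X i ^ m * X i ^ s) * (X j ^ m * X l ^ s * C c * PointBlowup.translate b (chartMap i U)) := by ring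
        _ = (X i ^ q * X i ^ d) * (X j ^ m * X l ^ s * C c * PointBlowup.translate b (chartMap i U)) := by rw [hx]
        _ = _ := by ring
    rw [hΨ, coeff_monomial_mul, one_mul]

end Walk

end Summit.ResolutionOfSingularities.ResolutionOfSingularities.Theorems.LossIsFatalLayer
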